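import Literature.NumberTheory.LFunctions.VinogradovKorobovLargeHeight
import Literature.NumberTheory.LFunctions.VinogradovKorobovLargeHeightNumerics

/-!
# The large-height argument of Mossinghoff–Trudgian–Yang (§5), II: the parameters `η`, `λ` and the three terms of the zero inequality

Topic `Literature/NumberTheory/LFunctions`. Part of the decomposition of
`Literature.NumberTheory.LFunctions.zero_free_region_vinogradov_korobov` (rh.S10 = Mossinghoff–Trudgian–Yang, *Res. Number
Theory* 10 (2024) = arXiv:2212.06867, Thm. 1.1; architecture in `VinogradovKorobov.lean`, arXiv
numbering throughout). This file and `VinogradovKorobovLargeHeightMain.lean` PROVE the named fact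
`Literature.NumberTheory.LFunctions.zero_bound_large_height_mossinghoff_trudgian_yang` (§5: every zero `β + it` with
`t ≥ T₀ = exp 52238` has `Z(β, t) = (1 − β)B^{2/3}(log t)^{2/3}(log log t)^{1/3} ≥ M₁ = 0.048976`,
`B = 4.45`) from the zero inequality Lemma 4.7
(`Literature.NumberTheory.LFunctions.zero_inequality_mossinghoff_trudgian_yang`, `VinogradovKorobovInputs.lean`), Ford's
bound (3.1) (`Literature.NumberTheory.LFunctions.zeta_bound_ford`) and Theorem 1.4
(`Literature.NumberTheory.LFunctions.zero_free_region_intermediate_mossinghoff_trudgian_yang`), following §5 of the source for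
a `(1 + δ)`-window-minimal counterexample `β + it`
(`Literature.NumberTheory.LFunctions.VK.exists_window_minimal_zero`, `VinogradovKorobovLargeHeight.lean`), `δ = 10⁻⁹`.
Theorem 1.4 enters only through `0 < Z(β, t)` (`mtyLam_pos`, `one_sub_div_mtyLam_eq`, `X_mem`); as
in `VinogradovKorobovLargeHeight.lean` these three come in a primed form assuming only
`IntermediateRegionFrom (exp 7000)` and an unprimed form taking Theorem 1.4 itself.
Contents of this file (everything proved; `t ≥ T₀` throughout):

* the quantities of §4–§5: `L₁ = log(40t + 1)` (`mtyL₁`), `L₂ = log L₁` (`mtyL₂`),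
  `η = E B^{-2/3}(L₂/L₁)^{2/3}` with `E = 1.8821259` ((4.11), `mtyEta`), the normaliser
  `N = B^{2/3}L₁^{2/3}L₂^{1/3}` (`mtyN`, so that the source's `M = λN`), and
  `λ = Z(β, t)/((1 + δ)N)` (`mtyLam`), with elementary enclosures
  (`L₁ ∈ log t + [3.6888794, 3.6888795]`, `L₂ ≥ 10.863636`, `L₂/L₁ ≤ 2.08·10⁻⁴`, `η ≤ 0.002442`,
  `1/N = η/(E L₂)`);
* **Step A, the hypotheses of Lemma 4.7** ((5.5)–(5.9) of the source): the rectangle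
  `1 − λ < Re s ≤ 1`, `t − 1 ≤ Im s ≤ 40t + 1` is zero-free (`zeroFreeRect_mtyLam`, from
  window-minimality), `λ ≤ 1 − β` (`mtyLam_le_one_sub`), `λ ≤ η/417` (`mtyLam_le_eta_div`, i.e.
  (5.7) with `R + 1 = 417`: `E L₂ ≥ 417 M₁`), `1 − β ≤ η/2` (`one_sub_le_eta_half`), `η ≤ 1/4`;
* **Step B, the left side**: `X := (1 − β)/λ − 1 = (1 + δ)(L₁/log t)^{2/3}(L₂/log log t)^{1/3} − 1`
  lies in `[0, X_max(δ)]`, `X_max(δ) = (1 + δ)(1 + 2ε/3)(1 + ε/(3 · 10.863565)) − 1`,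
  `ε = 3.6888795/52238` (`X_mem`; `X_max(10⁻⁹) = 4.92…·10⁻⁵`), so that the left side of Lemma 4.7
  is at least `λ⁻¹(0.4236636815659² − 0.20466 X_max)` (`lhs_coeff_ge`, with
  `cos θ ≥ 0.4236636815659`, `|W'(0)|b₁/(w(0)b₀) ≤ 0.20466` from `VinogradovKorobovNumerics.lean`).
  The source's (5.14) bounds `X` by `κ₄/log T₀ ≈ L₁/log t − 1 ≈ ε`; the exponent `2/3` kept here
  (`X ≈ 2ε/3`) is what restores a workable margin (see `VinogradovKorobovLargeHeightMain.lean`);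
* **Step C, the three terms of the right side** over `N`, in the atoms `a = L₁^{1/3}`,
  `c = L₂^{1/3}`, `d = B^{1/3}`, `s = √E` (`η = s²c²/(d²a²)`, `N = d²a²c`): `TA_le` ((5.11):
  `0.087π²(b₁/b₀)(1 − β)/η²`, using `1 − β < M₁/(B^{2/3}(log t)^{2/3}(log log t)^{1/3})`),
  `TB_le` ((5.12): the `(2η)⁻¹{…}` term, for any `log ζ(1 + η) ≤ η − log η` and
  `η ≤ 0.002442`; the source uses Ramaré's (3.2), `log ζ(1 + η) ≤ γη − log η`, and its display has
  `κ₂E/B^{2/3}` where `γη ≤ κ₂E` is meant — see the caveat in the docstring of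
  `Literature.NumberTheory.LFunctions.zero_bound_large_height_mossinghoff_trudgian_yang`; the elementary
  `ζ(σ) ≤ σ/(σ − 1)` used downstream costs `(1 − γ)η ≤ 1.1·10⁻³` in the bracket), `TC_le`
  ((5.13): the `C₅(R)(b/b₀)λ{…}` term, using `λ < M₁/N` and `C₅(416) ≤ 1.0241566`).

## References

* M. J. Mossinghoff, T. S. Trudgian, A. Yang, op. cit., §4 (4.11), §5 (5.5)–(5.14)
  (`MossinghoffTrudgianYangRNT2024`).
-/

noncomputable section
open Real Complex

namespace Literature.NumberTheory.LFunctions.VK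

/-! ### Cube-root algebra -/

/-- `x^{2/3} = (x^{1/3})²` for `x ≥ 0`. [folklore] -/
theorem rpow_two_thirds_eq_sq {x : ℝ} (hx : 0 ≤ x) : x ^ (2 / 3 : ℝ) = (x ^ (1 / 3 : ℝ)) ^ 2 := by
  rw [← Real.rpow_natCast, ← Real.rpow_mul hx]; norm_num

/-- `x^{4/3} = (x^{1/3})⁴` for `x ≥ 0`. [folklore] -/
theorem rpow_four_thirds_eq {x : ℝ} (hx : 0 ≤ x) : x ^ (4 / 3 : ℝ) = (x ^ (1 / 3 : ℝ)) ^ 4 := by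
  rw [← Real.rpow_natCast, ← Real.rpow_mul hx]; norm_num

/-- `x^{3/2} = x √x` for `x ≥ 0`. [folklore] -/
theorem rpow_three_halves_eq {x : ℝ} (hx : 0 ≤ x) : x ^ (3 / 2 : ℝ) = x * Real.sqrt x := by
  rw [show (3 / 2 : ℝ) = 1 + 1 / 2 by norm_num, Real.rpow_add' hx (by norm_num), Real.rpow_one,
    Real.sqrt_eq_rpow]

/-! ### `L₁ = log(40t + 1)`, `L₂ = log L₁`, `η`, and the normaliser `N = B^{2/3} L₁^{2/3} L₂^{1/3}` -/

/-- `L₁(t) = log(Kt + 1)` with `K = 40` (MTY §4). [cite: MossinghoffTrudgianYangRNT2024, §4 (L₁)] -/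
def mtyL₁ (t : ℝ) : ℝ := Real.log (40 * t + 1)

/-- `L₂(t) = log log(Kt + 1)` with `K = 40` (MTY §4). [cite: MossinghoffTrudgianYangRNT2024, §4 (L₂)] -/
def mtyL₂ (t : ℝ) : ℝ := Real.log (mtyL₁ t)

/-- `η(t) = E (L₂/(B L₁))^{2/3} = E B^{-2/3} (L₂/L₁)^{2/3}`, `E = 1.8821259`, `B = 4.45` (MTY (4.11)).
[cite: MossinghoffTrudgianYangRNT2024, (4.11)] -/
def mtyEta (t : ℝ) : ℝ :=
  1.8821259 * ((4.45 : ℝ) ^ (2 / 3 : ℝ))⁻¹ * (mtyL₂ t / mtyL₁ t) ^ (2 / 3 : ℝ)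

/-- The normaliser `N(t) = B^{2/3} L₁^{2/3} L₂^{1/3}` of §5 (`M = λ N`). [cite: MossinghoffTrudgianYangRNT2024, §5] -/
def mtyN (t : ℝ) : ℝ :=
  (4.45 : ℝ) ^ (2 / 3 : ℝ) * mtyL₁ t ^ (2 / 3 : ℝ) * mtyL₂ t ^ (1 / 3 : ℝ)

section bounds

variable {t : ℝ} (ht : Real.exp 52238 ≤ t)
include ht

/-- `t > 0`. [folklore] -/
theorem t_pos : 0 < t := (Real.exp_pos _).trans_le ht

/-- `log t ≥ 52238`. [folklore] -/
theorem log_t_ge : 52238 ≤ Real.log t := by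
  rw [Real.le_log_iff_exp_le (t_pos ht)]; exact ht

/-- `L₁ ≥ log t + 3.6888794` (`L₁ ≥ log(40t) = log 40 + log t`). [folklore] -/
theorem mtyL₁_ge : Real.log t + 3.6888794 ≤ mtyL₁ t := by
  have h0 := t_pos ht
  have h40 := log_40_mem.1
  unfold mtyL₁
  calc Real.log t + 3.6888794 ≤ Real.log t + Real.log 40 := by linarith
    _ = Real.log (40 * t) := by rw [Real.log_mul (by norm_num) h0.ne']; ring
    _ ≤ Real.log (40 * t + 1) := Real.log_le_log (by positivity) (by linarith)

/-- `L₁ ≤ log t + 3.6888795` (`log(40t + 1) ≤ log(40t) + 1/(40t)`). [folklore] -/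
theorem mtyL₁_le : mtyL₁ t ≤ Real.log t + 3.6888795 := by
  have h0 := t_pos ht
  have h40 := log_40_mem.2
  have hbig : (10 : ℝ) ^ 8 ≤ t := le_trans (by
    have := Real.quadratic_le_exp_of_nonneg (show (0 : ℝ) ≤ 52238 by norm_num)
    norm_num at this ⊢; linarith) ht
  unfold mtyL₁
  have h1 : Real.log (40 * t + 1) = Real.log (40 * t) + Real.log (1 + 1 / (40 * t)) := by
    rw [← Real.log_mul (by positivity) (by positivity)]; congr 1; field_simp
  have h2 : Real.log (1 + 1 / (40 * t)) ≤ 1 / (40 * t) := by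
    have := Real.log_le_sub_one_of_pos (show (0 : ℝ) < 1 + 1 / (40 * t) by positivity); linarith
  have h3 : 1 / (40 * t) ≤ 1 / (40 * 10 ^ 8) := by gcongr
  have h3' : 1 / (40 * t) ≤ 1e-9 := h3.trans (by norm_num)
  rw [h1, Real.log_mul (by norm_num) h0.ne']
  linarith

/-- `L₁ ≥ 52241.6888794`. [folklore] -/
theorem mtyL₁_ge' : 52241.6888794 ≤ mtyL₁ t := by
  have := mtyL₁_ge ht; have := log_t_ge ht; linarith

/-- `L₁ > 0`. [folklore] -/
theorem mtyL₁_pos : 0 < mtyL₁ t := lt_of_lt_of_le (by norm_num) (mtyL₁_ge' ht)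

/-- `L₂ ≥ 10.863636`. [folklore] -/
theorem mtyL₂_ge : 10.863636 ≤ mtyL₂ t := by
  unfold mtyL₂
  rw [Real.le_log_iff_exp_le (mtyL₁_pos ht)]
  refine le_trans ?_ (mtyL₁_ge' ht)
  exact exp_le_of_expUB_le (k := 10) (f := 0.863636) (X := 52241.6888794) (by norm_num)
    (by norm_num) (by norm_num [expUB]) |>.trans_eq' (by norm_num)

/-- `L₂ > 0`. [folklore] -/
theorem mtyL₂_pos : 0 < mtyL₂ t := lt_of_lt_of_le (by norm_num) (mtyL₂_ge ht)

/-- `L₂ ≤ log(log t + 3.6888795)`. [folklore] -/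
theorem mtyL₂_le : mtyL₂ t ≤ Real.log (Real.log t + 3.6888795) :=
  Real.log_le_log (mtyL₁_pos ht) (mtyL₁_le ht)

/-- `L₂ < L₁`. [folklore] -/
theorem mtyL₂_lt_L₁ : mtyL₂ t < mtyL₁ t := by
  unfold mtyL₂
  have := Real.log_le_sub_one_of_pos (mtyL₁_pos ht); linarith

/-- `L₂/L₁ ≤ 0.00020795` (`log x/x` is decreasing on `[e, ∞)`). [folklore] -/
theorem mtyL₂_div_L₁_le : mtyL₂ t / mtyL₁ t ≤ 10.8636361 / 52241.6888794 := by
  have hanti := Real.log_div_self_antitoneOn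
  have he : Real.exp 1 ≤ (52241.6888794 : ℝ) := by
    have := Real.exp_one_lt_d9; linarith
  have h1 : Real.log (mtyL₁ t) / mtyL₁ t ≤ Real.log 52241.6888794 / 52241.6888794 :=
    hanti he (le_trans he (mtyL₁_ge' ht)) (mtyL₁_ge' ht)
  have h2 : Real.log 52241.6888794 ≤ 10.8636361 := by
    rw [Real.log_le_iff_le_exp (by norm_num)]
    exact le_exp_of_le_expLB (k := 10) (f := 0.8636361) (by norm_num)
      (by norm_num [expLB, Finset.sum_range_succ, Nat.factorial]) |>.trans_eq (by norm_num)
  unfold mtyL₂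
  exact h1.trans (by gcongr)

/-- `η > 0`. [folklore] -/
theorem mtyEta_pos : 0 < mtyEta t := by
  unfold mtyEta
  have := mtyL₁_pos ht; have := mtyL₂_pos ht
  positivity

/-- `η ≤ 0.002442` (its value at `T₀` is `0.0024418…`). [folklore] -/
theorem mtyEta_le : mtyEta t ≤ 0.002442 := by
  have hr := mtyL₂_div_L₁_le ht
  have hr0 : 0 ≤ mtyL₂ t / mtyL₁ t := (div_pos (mtyL₂_pos ht) (mtyL₁_pos ht)).le
  have h1 : (mtyL₂ t / mtyL₁ t) ^ (2 / 3 : ℝ) ≤ 0.00351018 := by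
    refine le_of_pow_le_pow_left₀ (n := 3) (by norm_num) (by norm_num) ?_
    rw [rpow_two_thirds_pow_three hr0]
    calc (mtyL₂ t / mtyL₁ t) ^ 2 ≤ (10.8636361 / 52241.6888794) ^ 2 := pow_le_pow_left₀ hr0 hr 2
      _ ≤ _ := by norm_num
  have hB := ford_B_two_thirds_ge
  have hBinv : ((4.45 : ℝ) ^ (2 / 3 : ℝ))⁻¹ ≤ 2.70545⁻¹ := by
    rw [inv_le_inv₀ (by positivity) (by norm_num)]; exact hB
  unfold mtyEta
  calc 1.8821259 * ((4.45 : ℝ) ^ (2 / 3 : ℝ))⁻¹ * (mtyL₂ t / mtyL₁ t) ^ (2 / 3 : ℝ)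
      ≤ 1.8821259 * 2.70545⁻¹ * 0.00351018 :=
        mul_le_mul (mul_le_mul_of_nonneg_left hBinv (by norm_num)) h1 (by positivity) (by positivity)
    _ ≤ _ := by norm_num

/-- `N > 0`. [folklore] -/
theorem mtyN_pos : 0 < mtyN t := by
  unfold mtyN
  have := mtyL₁_pos ht; have := mtyL₂_pos ht
  positivity

/-- The identity `1/N = η/(E L₂)` (`M₁/(B^{2/3}L₁^{2/3}L₂^{1/3}) = η M₁/(E L₂)`, MTY (5.7)).
[cite: MossinghoffTrudgianYangRNT2024, (5.7)] -/
theorem inv_mtyN_eq : (mtyN t)⁻¹ = mtyEta t / (1.8821259 * mtyL₂ t) := by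
  have hL1 := mtyL₁_pos ht
  have hL2 := mtyL₂_pos ht
  set a := mtyL₁ t ^ (1 / 3 : ℝ) with ha
  set c := mtyL₂ t ^ (1 / 3 : ℝ) with hc
  have ha0 : 0 < a := Real.rpow_pos_of_pos hL1 _
  have hc0 : 0 < c := Real.rpow_pos_of_pos hL2 _
  have ha3 : a ^ 3 = mtyL₁ t := rpow_one_third_pow_three hL1.le
  have hc3 : c ^ 3 = mtyL₂ t := rpow_one_third_pow_three hL2.le
  have hB0 : 0 < (4.45 : ℝ) ^ (2 / 3 : ℝ) := by positivity
  unfold mtyN mtyEta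
  rw [Real.div_rpow hL2.le hL1.le, rpow_two_thirds_eq_sq hL1.le, rpow_two_thirds_eq_sq hL2.le,
    ← ha, ← hc]
  rw [← hc3]
  field_simp

end bounds

/-! ### The parameter `λ` and the hypotheses of Lemma 4.7 -/

/-- `λ = Z(β,t)/((1+δ) N(t))`, the §5 parameter `λ = M/(B^{2/3}L₁^{2/3}L₂^{1/3})` with `M` replaced
by `Z(β, t)/(1 + δ)` for a `(1+δ)`-window-minimal zero `β + it` (see
`exists_window_minimal_zero`). [cite: MossinghoffTrudgianYangRNT2024, §5 (definition of λ)] -/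
def mtyLam (δ β t : ℝ) : ℝ :=
  mtyZ β t / ((1 + δ) * mtyN t)

section lam

variable {δ β t : ℝ} (hδ : 0 < δ) (ht : Real.exp 52238 ≤ t) (hz : riemannZeta (β + t * I) = 0)
  (hZ : mtyZ β t < 0.048976)

omit hδ hz hZ in
/-- For a zero `β' + it'` with `exp 52237.99 ≤ t' ≤ 40t + 1`: `Z(β', t') ≤ (1 − β') N(t)`
(`log t' ≤ L₁`, `log log t' ≤ L₂`). [cite: MossinghoffTrudgianYangRNT2024, §5 (proof of (5.5)–(5.6))] -/
theorem mtyZ_le_mul_N {β' t' : ℝ} (h1 : Real.exp 52237.99 ≤ t') (h2 : t' ≤ 40 * t + 1)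
    (hz' : riemannZeta (β' + t' * I) = 0) : mtyZ β' t' ≤ (1 - β') * mtyN t := by
  have ht'0 : 0 < t' := (Real.exp_pos _).trans_le h1
  have hu1 : 52237.99 ≤ Real.log t' := by rw [Real.le_log_iff_exp_le ht'0]; exact h1
  have hβ' : 0 < 1 - β' := by
    rw [sub_pos]; by_contra hc
    exact riemannZeta_ne_zero_of_one_le_re (s := β' + t' * I) (by simp [not_lt.1 hc]) hz'
  have hlog : Real.log t' ≤ mtyL₁ t := by
    unfold mtyL₁; exact Real.log_le_log ht'0 (by linarith)
  have hll : Real.log (Real.log t') ≤ mtyL₂ t := by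
    unfold mtyL₂; exact Real.log_le_log (by linarith) hlog
  have hll0 : 0 ≤ Real.log (Real.log t') := Real.log_nonneg (by linarith)
  have e1 : Real.log t' ^ (2 / 3 : ℝ) ≤ mtyL₁ t ^ (2 / 3 : ℝ) :=
    Real.rpow_le_rpow (by linarith) hlog (by norm_num)
  have e2 : Real.log (Real.log t') ^ (1 / 3 : ℝ) ≤ mtyL₂ t ^ (1 / 3 : ℝ) :=
    Real.rpow_le_rpow hll0 hll (by norm_num)
  unfold mtyZ mtyN
  have hB : 0 ≤ (4.45 : ℝ) ^ (2 / 3 : ℝ) := by positivity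
  calc (1 - β') * (4.45 : ℝ) ^ (2 / 3 : ℝ) * Real.log t' ^ (2 / 3 : ℝ) * Real.log (Real.log t') ^ (1 / 3 : ℝ)
      = (1 - β') * ((4.45 : ℝ) ^ (2 / 3 : ℝ) * (Real.log t' ^ (2 / 3 : ℝ) * Real.log (Real.log t') ^ (1 / 3 : ℝ))) := by ring
    _ ≤ (1 - β') * ((4.45 : ℝ) ^ (2 / 3 : ℝ) * (mtyL₁ t ^ (2 / 3 : ℝ) * mtyL₂ t ^ (1 / 3 : ℝ))) := by
        apply mul_le_mul_of_nonneg_left _ hβ'.le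
        apply mul_le_mul_of_nonneg_left _ hB
        exact mul_le_mul e1 e2 (Real.rpow_nonneg hll0 _) (Real.rpow_nonneg (by linarith) _)
    _ = _ := by ring

include hδ ht hz in
/-- `0 < λ` (form assuming Theorem 1.4 only from height `exp 7000`). [folklore] -/
theorem mtyLam_pos' (hI : IntermediateRegionFrom (Real.exp 7000)) : 0 < mtyLam δ β t := by
  unfold mtyLam
  have hN := mtyN_pos ht
  have hZ0 : 0 < mtyZ β t := by
    have := mtyZ_mul_rpow_ge' hI ht hz
    have hr : 0 < Real.log t ^ (1 / 3 : ℝ) := Real.rpow_pos_of_pos (by have := log_t_ge ht; linarith) _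
    by_contra hc; push Not at hc
    nlinarith [mul_nonpos_of_nonpos_of_nonneg hc hr.le]
  positivity

include hδ ht hz in
/-- `0 < λ`. [folklore] -/
theorem mtyLam_pos (hI : zero_free_region_intermediate_mossinghoff_trudgian_yang) :
    0 < mtyLam δ β t :=
  mtyLam_pos' hδ ht hz (intermediateRegionFrom_exp_7000 hI)

include hδ ht hz in
/-- `λ ≤ (1 − β)/(1 + δ) ≤ 1 − β` (as `Z(β,t) ≤ (1 − β) N`; MTY (5.6)). [cite: MossinghoffTrudgianYangRNT2024, (5.6)] -/
theorem mtyLam_le_one_sub : mtyLam δ β t ≤ 1 - β := by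
  have hN := mtyN_pos ht
  have h1 : Real.exp 52237.99 ≤ t := (Real.exp_le_exp.2 (by norm_num)).trans ht
  have h2 : t ≤ 40 * t + 1 := by have := t_pos ht; linarith
  have hle := mtyZ_le_mul_N h1 h2 hz
  have hβ : 0 < 1 - β := by
    rw [sub_pos]; by_contra hc
    exact riemannZeta_ne_zero_of_one_le_re (s := β + t * I) (by simp [not_lt.1 hc]) hz
  unfold mtyLam
  rw [div_le_iff₀ (by positivity)]
  have : 0 ≤ (1 - β) * (δ * mtyN t) := by positivity
  nlinarith

include hδ ht in
/-- **(5.5): the rectangle `1 − λ < Re s ≤ 1`, `t − 1 ≤ Im s ≤ 40t + 1` is zero-free** for a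
`(1+δ)`-window-minimal zero. [cite: MossinghoffTrudgianYangRNT2024, (5.5)] -/
theorem zeroFreeRect_mtyLam
    (hmin : ∀ β' t' : ℝ, t - 1 ≤ t' → t' ≤ 40 * t + 1 → riemannZeta (β' + t' * I) = 0 →
      mtyZ β t ≤ (1 + δ) * mtyZ β' t') :
    ZetaZeroFreeRect (mtyLam δ β t) t (40 * t + 1) := by
  intro s h1 h2 h3 h4 hs
  have hN := mtyN_pos ht
  have hs' : riemannZeta (s.re + s.im * I) = 0 := by rwa [Complex.re_add_im]
  have ht'1 : Real.exp 52237.99 ≤ s.im := exp_le_T0_sub_one.trans (by linarith)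
  have hle := mtyZ_le_mul_N ht'1 h4 hs'
  have hm := hmin s.re s.im h3 h4 hs'
  have key : mtyLam δ β t ≤ 1 - s.re := by
    unfold mtyLam
    rw [div_le_iff₀ (by positivity)]
    calc mtyZ β t ≤ (1 + δ) * mtyZ s.re s.im := hm
      _ ≤ (1 + δ) * ((1 - s.re) * mtyN t) := mul_le_mul_of_nonneg_left hle (by linarith)
      _ = _ := by ring
  linarith

include hδ ht hZ in
/-- **(5.7): `λ ≤ η/(R + 1)` with `R = 416`** (`λ < M₁/N = η M₁/(E L₂)` and `E L₂ ≥ 417 M₁`,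
i.e. `L₂ ≥ 10.851`). [cite: MossinghoffTrudgianYangRNT2024, (5.7)] -/
theorem mtyLam_le_eta_div : mtyLam δ β t ≤ mtyEta t / (416 + 1) := by
  have hN := mtyN_pos ht
  have hL2 := mtyL₂_ge ht
  have hη := mtyEta_pos ht
  have hinv := inv_mtyN_eq ht
  have h1 : mtyLam δ β t ≤ 0.048976 * (mtyN t)⁻¹ := by
    unfold mtyLam
    rw [div_eq_mul_inv, mul_inv, ← mul_assoc]
    have : mtyZ β t * (1 + δ)⁻¹ ≤ 0.048976 := by
      rw [mul_inv_le_iff₀ (by linarith)]; nlinarith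
    exact mul_le_mul_of_nonneg_right this (inv_nonneg.2 hN.le)
  rw [hinv] at h1
  refine h1.trans ?_
  rw [mul_div_assoc', div_le_div_iff₀ (by positivity) (by norm_num)]
  nlinarith

include ht hz hZ in
/-- **(5.8): `1 − β < η/2`** (`1 − β < M₁/(B^{2/3}(log t)^{2/3}(log log t)^{1/3})`, far below
`η/2 = E(L₂/L₁)^{2/3}/(2B^{2/3})`). [cite: MossinghoffTrudgianYangRNT2024, (5.8)] -/
theorem one_sub_le_eta_half : 1 - β ≤ mtyEta t / 2 := by
  have ht0 := t_pos ht
  have hu := log_t_ge ht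
  have hL1 := mtyL₁_pos ht
  have hL1u : mtyL₁ t ≤ 2 * Real.log t := by
    unfold mtyL₁
    have h41 : (41 : ℝ) ≤ t := le_trans (by have := Real.add_one_le_exp (52238 : ℝ); linarith) ht
    have : 40 * t + 1 ≤ t ^ 2 := by nlinarith
    calc Real.log (40 * t + 1) ≤ Real.log (t ^ 2) := Real.log_le_log (by positivity) this
      _ = 2 * Real.log t := by rw [Real.log_pow]; norm_num
  have hL2 := mtyL₂_ge ht
  have hll := loglog_rpow_third_ge hu
  -- Z = (1-β) B23 u^{2/3} ll^{1/3} < M1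
  have hβ : 0 < 1 - β := by
    rw [sub_pos]; by_contra hc
    exact riemannZeta_ne_zero_of_one_le_re (s := β + t * I) (by simp [not_lt.1 hc]) hz
  have hB1 := ford_B_two_thirds_ge
  have hB2 := ford_B_two_thirds_le
  -- lower bound of η/2: (E/(2 B23)) (L2/L1)^{2/3} ≥ (E/(2·2.705454)) L2^{2/3} / (2u)^{2/3}
  have hu23 : 0 < Real.log t ^ (2 / 3 : ℝ) := Real.rpow_pos_of_pos (by linarith) _
  have hfrac : mtyL₂ t ^ (2 / 3 : ℝ) / (2 * Real.log t) ^ (2 / 3 : ℝ) ≤ (mtyL₂ t / mtyL₁ t) ^ (2 / 3 : ℝ) := by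
    rw [Real.div_rpow (by linarith) hL1.le]
    apply div_le_div_of_nonneg_left (Real.rpow_nonneg (by linarith) _) (Real.rpow_pos_of_pos hL1 _)
    exact Real.rpow_le_rpow hL1.le hL1u (by norm_num)
  have h2u : (2 * Real.log t) ^ (2 / 3 : ℝ) ≤ 1.5875 * Real.log t ^ (2 / 3 : ℝ) := by
    rw [Real.mul_rpow (by norm_num) (by linarith)]
    apply mul_le_mul_of_nonneg_right _ hu23.le
    refine le_of_pow_le_pow_left₀ (n := 3) (by norm_num) (by norm_num) ?_
    rw [rpow_two_thirds_pow_three (by norm_num)]; norm_num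
  have hL2r : 4.9 ≤ mtyL₂ t ^ (2 / 3 : ℝ) := by
    refine le_of_pow_le_pow_left₀ (n := 3) (by norm_num) (by positivity) ?_
    rw [rpow_two_thirds_pow_three (by linarith)]; nlinarith
  -- 1 - β < M1 / (B23 u^{2/3} ll^{1/3})
  have hZ' : (1 - β) * ((4.45 : ℝ) ^ (2 / 3 : ℝ) * Real.log t ^ (2 / 3 : ℝ) * Real.log (Real.log t) ^ (1 / 3 : ℝ))
      < 0.048976 := by
    have : mtyZ β t = (1 - β) * ((4.45 : ℝ) ^ (2 / 3 : ℝ) * Real.log t ^ (2 / 3 : ℝ)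
        * Real.log (Real.log t) ^ (1 / 3 : ℝ)) := by unfold mtyZ; ring
    rw [← this]; exact hZ
  -- Goal: 1 - β ≤ η/2. Strategy: (1-β) * D < M1 with D := B23 u^{2/3} ll^{1/3} ≥ 2.70545 u^{2/3} 2.2147,
  -- and η/2 * D ≥ (E/2) (L2^{2/3}/(1.5875 u^{2/3})) u^{2/3} 2.2147·(B23/B23) ... ≥ M1.
  have hD : 2.70545 * Real.log t ^ (2 / 3 : ℝ) * 2.2147
      ≤ (4.45 : ℝ) ^ (2 / 3 : ℝ) * Real.log t ^ (2 / 3 : ℝ) * Real.log (Real.log t) ^ (1 / 3 : ℝ) :=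
    mul_le_mul (mul_le_mul_of_nonneg_right hB1 hu23.le) hll (by norm_num) (by positivity)
  have hD0 : 0 < 2.70545 * Real.log t ^ (2 / 3 : ℝ) * 2.2147 := by positivity
  have h1β : (1 - β) * (2.70545 * Real.log t ^ (2 / 3 : ℝ) * 2.2147) < 0.048976 :=
    lt_of_le_of_lt (mul_le_mul_of_nonneg_left hD hβ.le) hZ'
  -- η/2 ≥ (E/(2 B23)) · L2^{2/3}/(1.5875 u^{2/3})
  have hBinv : (2.705454 : ℝ)⁻¹ ≤ ((4.45 : ℝ) ^ (2 / 3 : ℝ))⁻¹ := by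
    rw [inv_le_inv₀ (by norm_num) (by positivity)]; exact hB2
  have hQ : 4.9 / (1.5875 * Real.log t ^ (2 / 3 : ℝ)) ≤ (mtyL₂ t / mtyL₁ t) ^ (2 / 3 : ℝ) :=
    calc 4.9 / (1.5875 * Real.log t ^ (2 / 3 : ℝ))
        ≤ mtyL₂ t ^ (2 / 3 : ℝ) / (2 * Real.log t) ^ (2 / 3 : ℝ) :=
          div_le_div₀ (Real.rpow_nonneg (by linarith) _) hL2r (by positivity) h2u
      _ ≤ _ := hfrac
  have hη : 1.8821259 * 2.705454⁻¹ * (4.9 / (1.5875 * Real.log t ^ (2 / 3 : ℝ))) / 2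
      ≤ mtyEta t / 2 := by
    unfold mtyEta
    apply div_le_div_of_nonneg_right _ (by norm_num)
    exact mul_le_mul (mul_le_mul_of_nonneg_left hBinv (by norm_num)) hQ (by positivity)
      (by positivity)
  -- combine: (1-β) ≤ M1/(2.70545·2.2147 u^{2/3}) ≤ η/2
  have step : 1 - β ≤ 0.048976 / (2.70545 * Real.log t ^ (2 / 3 : ℝ) * 2.2147) := by
    rw [le_div_iff₀ hD0]; exact h1β.le
  refine step.trans (le_trans ?_ hη)
  set v := Real.log t ^ (2 / 3 : ℝ) with hv
  have e1 : 0.048976 / (2.70545 * v * 2.2147) = (0.048976 / (2.70545 * 2.2147)) * v⁻¹ := by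
    field_simp
  have e2 : 1.8821259 * 2.705454⁻¹ * (4.9 / (1.5875 * v)) / 2
      = (1.8821259 * 4.9 / (2.705454 * 1.5875 * 2)) * v⁻¹ := by
    field_simp
  rw [e1, e2]
  exact mul_le_mul_of_nonneg_right (by norm_num) (inv_nonneg.2 hu23.le)

end lam

/-! ### Step B: `X = (1 − β)/λ − 1` and the left-hand side of Lemma 4.7 -/

section stepB

variable {δ β t : ℝ} (hδ : 0 < δ) (ht : Real.exp 52238 ≤ t) (hz : riemannZeta (β + t * I) = 0)

include ht hz in
/-- `(1 − β)/λ = (1 + δ)(L₁/log t)^{2/3}(L₂/log log t)^{1/3} ≥ 1` (the quantity whose excess over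
`1` is bounded by `κ₄/log T₀` in MTY (5.14)); form assuming Theorem 1.4 only from height
`exp 7000`. [cite: MossinghoffTrudgianYangRNT2024, (5.14)] -/
theorem one_sub_div_mtyLam_eq' (hI : IntermediateRegionFrom (Real.exp 7000))
    (hδ : 0 < δ) :
    1 ≤ (1 - β) / mtyLam δ β t ∧
      (1 - β) / mtyLam δ β t = (1 + δ) * ((mtyL₁ t / Real.log t) ^ (2 / 3 : ℝ)
        * (mtyL₂ t / Real.log (Real.log t)) ^ (1 / 3 : ℝ)) := by
  have ht0 := t_pos ht
  have hu := log_t_ge ht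
  have hu0 : 0 < Real.log t := by linarith
  have hL1 := mtyL₁_pos ht
  have hL2 := mtyL₂_pos ht
  have hN := mtyN_pos ht
  have hlam := mtyLam_pos' hδ ht hz hI
  have hβ : 0 < 1 - β := by
    rw [sub_pos]; by_contra hc
    exact riemannZeta_ne_zero_of_one_le_re (s := β + t * I) (by simp [not_lt.1 hc]) hz
  have hll0 : 0 < Real.log (Real.log t) := Real.log_pos (by linarith)
  have huL : Real.log t ≤ mtyL₁ t := by have := mtyL₁_ge ht; linarith
  have hllL : Real.log (Real.log t) ≤ mtyL₂ t := Real.log_le_log hu0 huL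
  set D := (4.45 : ℝ) ^ (2 / 3 : ℝ) * Real.log t ^ (2 / 3 : ℝ) * Real.log (Real.log t) ^ (1 / 3 : ℝ)
    with hD
  have hD0 : 0 < D := by positivity
  have hZ : mtyZ β t = (1 - β) * D := by unfold mtyZ; rw [hD]; ring
  have hform : (1 - β) / mtyLam δ β t = (1 + δ) * (mtyN t / D) := by
    unfold mtyLam; rw [hZ]; field_simp
  have hDN : D ≤ mtyN t := by
    unfold mtyN; rw [hD]
    apply mul_le_mul (mul_le_mul_of_nonneg_left (Real.rpow_le_rpow hu0.le huL (by norm_num)) (by positivity))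
      (Real.rpow_le_rpow hll0.le hllL (by norm_num)) (by positivity) (by positivity)
  rw [hform]
  constructor
  · have : 1 ≤ mtyN t / D := by rw [le_div_iff₀ hD0]; linarith
    nlinarith
  · congr 1
    unfold mtyN; rw [hD, Real.div_rpow hL1.le hu0.le, Real.div_rpow hL2.le hll0.le]
    field_simp

include ht hz in
/-- `(1 − β)/λ = (1 + δ)(L₁/log t)^{2/3}(L₂/log log t)^{1/3} ≥ 1` (the quantity whose excess over
`1` is bounded by `κ₄/log T₀` in MTY (5.14)). [cite: MossinghoffTrudgianYangRNT2024, (5.14)] -/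
theorem one_sub_div_mtyLam_eq (hI : zero_free_region_intermediate_mossinghoff_trudgian_yang)
    (hδ : 0 < δ) :
    1 ≤ (1 - β) / mtyLam δ β t ∧
      (1 - β) / mtyLam δ β t = (1 + δ) * ((mtyL₁ t / Real.log t) ^ (2 / 3 : ℝ)
        * (mtyL₂ t / Real.log (Real.log t)) ^ (1 / 3 : ℝ)) :=
  one_sub_div_mtyLam_eq' ht hz (intermediateRegionFrom_exp_7000 hI) hδ

include ht in
/-- `log log t ≥ 10.863565` for `t ≥ T₀` (`exp 10.863565 ≤ 52238`). [folklore] -/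
theorem loglog_t_ge : 10.863565 ≤ Real.log (Real.log t) := by
  have hu := log_t_ge ht
  have h : ((10 : ℕ) : ℝ) + 0.863565 ≤ Real.log (Real.log t) := by
    rw [Real.le_log_iff_exp_le (by linarith)]
    exact (exp_le_of_expUB_le (by norm_num) (by norm_num) (by norm_num [expUB])).trans hu
  have e : (((10 : ℕ) : ℝ) + 0.863565) = 10.863565 := by norm_num
  linarith

include ht in
/-- `(L₁/log t)^{2/3} ≤ 1 + (2/3)ε`, `ε = 3.6888795/52238 ≥ L₁/log t − 1`
(`(1 + ε)² ≤ (1 + 2ε/3)³`). [folklore] -/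
theorem L₁_ratio_rpow_le :
    (mtyL₁ t / Real.log t) ^ (2 / 3 : ℝ) ≤ 1 + 2 / 3 * (3.6888795 / 52238) := by
  have hu := log_t_ge ht
  have hu0 : 0 < Real.log t := by linarith
  have hL := mtyL₁_le ht
  have hL1 := mtyL₁_pos ht
  have hq0 : 0 ≤ mtyL₁ t / Real.log t := by positivity
  have hq : mtyL₁ t / Real.log t ≤ 1 + 3.6888795 / 52238 := by
    rw [div_le_iff₀ hu0]
    have : 3.6888795 / 52238 * 52238 ≤ 3.6888795 / 52238 * Real.log t := by gcongr
    nlinarith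
  refine le_of_pow_le_pow_left₀ (n := 3) (by norm_num) (by norm_num) ?_
  rw [rpow_two_thirds_pow_three hq0]
  calc (mtyL₁ t / Real.log t) ^ 2 ≤ (1 + 3.6888795 / 52238) ^ 2 := pow_le_pow_left₀ hq0 hq 2
    _ ≤ _ := by norm_num

include ht in
/-- `(L₂/log log t)^{1/3} ≤ 1 + ε/(3 · 10.863565)`: `L₂ = log L₁ ≤ log log t + log(1 + ε)
≤ log log t + ε` and `log log t ≥ 10.863565` (`1 + x ≤ (1 + x/3)³`). [folklore] -/
theorem L₂_ratio_rpow_le :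
    (mtyL₂ t / Real.log (Real.log t)) ^ (1 / 3 : ℝ) ≤ 1 + 3.6888795 / 52238 / (3 * 10.863565) := by
  have hu := log_t_ge ht
  have hu0 : 0 < Real.log t := by linarith
  have hll := loglog_t_ge ht
  have hll0 : 0 < Real.log (Real.log t) := by linarith
  have hL := mtyL₁_le ht
  have hL1 := mtyL₁_pos ht
  have hL2 := mtyL₂_pos ht
  -- L₂ ≤ log log t + ε
  have h1 : mtyL₂ t ≤ Real.log (Real.log t) + 3.6888795 / 52238 := by
    have hq : mtyL₁ t ≤ Real.log t * (1 + 3.6888795 / 52238) := by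
      have : 3.6888795 / 52238 * 52238 ≤ 3.6888795 / 52238 * Real.log t := by gcongr
      nlinarith
    unfold mtyL₂
    calc Real.log (mtyL₁ t) ≤ Real.log (Real.log t * (1 + 3.6888795 / 52238)) :=
          Real.log_le_log hL1 hq
      _ = Real.log (Real.log t) + Real.log (1 + 3.6888795 / 52238) := by
          rw [Real.log_mul hu0.ne' (by norm_num)]
      _ ≤ Real.log (Real.log t) + 3.6888795 / 52238 := by
          have := Real.log_le_sub_one_of_pos (show (0:ℝ) < 1 + 3.6888795 / 52238 by norm_num)
          linarith
  have hq0 : 0 ≤ mtyL₂ t / Real.log (Real.log t) := by positivity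
  have hq : mtyL₂ t / Real.log (Real.log t) ≤ 1 + 3.6888795 / 52238 / 10.863565 := by
    rw [div_le_iff₀ hll0]
    have : 3.6888795 / 52238 / 10.863565 * 10.863565
        ≤ 3.6888795 / 52238 / 10.863565 * Real.log (Real.log t) := by gcongr
    nlinarith
  refine le_of_pow_le_pow_left₀ (n := 3) (by norm_num) (by norm_num) ?_
  rw [rpow_one_third_pow_three hq0]
  calc mtyL₂ t / Real.log (Real.log t) ≤ 1 + 3.6888795 / 52238 / 10.863565 := hq
    _ ≤ _ := by norm_num

/-- `X_max(δ) := (1 + δ)(1 + 2ε/3)(1 + ε/(3 · 10.863565)) − 1`, `ε = 3.6888795/52238`: an upper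
bound for `X = (1 − β)/λ − 1` (the rôle of `κ₄/log T₀` in MTY (5.14); numerically
`X_max(10⁻⁹) = 4.92…·10⁻⁵`). [cite: MossinghoffTrudgianYangRNT2024, (5.14)] -/
def mtyXmax (δ : ℝ) : ℝ :=
  (1 + δ) * ((1 + 2 / 3 * (3.6888795 / 52238)) * (1 + 3.6888795 / 52238 / (3 * 10.863565))) - 1

include ht hz in
/-- `0 ≤ X = (1 − β)/λ − 1 ≤ X_max(δ)` (form assuming Theorem 1.4 only from height `exp 7000`).
[cite: MossinghoffTrudgianYangRNT2024, (5.14)] -/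
theorem X_mem' (hI : IntermediateRegionFrom (Real.exp 7000)) (hδ : 0 < δ) :
    0 ≤ (1 - β) / mtyLam δ β t - 1 ∧ (1 - β) / mtyLam δ β t - 1 ≤ mtyXmax δ := by
  obtain ⟨h1, h2⟩ := one_sub_div_mtyLam_eq' ht hz hI hδ
  refine ⟨by linarith, ?_⟩
  rw [h2]
  unfold mtyXmax
  have e1 := L₁_ratio_rpow_le ht
  have e2 := L₂_ratio_rpow_le ht
  have hll := loglog_t_ge ht
  have h0 : 0 ≤ (mtyL₂ t / Real.log (Real.log t)) ^ (1 / 3 : ℝ) :=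
    Real.rpow_nonneg (div_nonneg (mtyL₂_pos ht).le (by linarith)) _
  have := mul_le_mul e1 e2 h0 (by norm_num)
  nlinarith

include ht hz in
/-- `0 ≤ X = (1 − β)/λ − 1 ≤ X_max(δ)`. [cite: MossinghoffTrudgianYangRNT2024, (5.14)] -/
theorem X_mem (hI : zero_free_region_intermediate_mossinghoff_trudgian_yang) (hδ : 0 < δ) :
    0 ≤ (1 - β) / mtyLam δ β t - 1 ∧ (1 - β) / mtyLam δ β t - 1 ≤ mtyXmax δ :=
  X_mem' ht hz (intermediateRegionFrom_exp_7000 hI) hδ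

/-- **The left-hand side of Lemma 4.7, bounded below**: with `cos θ ≥ 0.4236636815659`,
`|W'(0)|b₁/(w(0)b₀) ≤ 0.20466` and `0 ≤ X ≤ X_max`,
`cos²θ − (|W'(0)|b₁/(w(0)b₀)) X ≥ 0.4236636815659² − 0.20466 X_max` (cf. MTY (5.10), (5.14), where
the roundings `0.17949` and `0.755/log T₀` are used). [cite: MossinghoffTrudgianYangRNT2024, (5.10)] -/
theorem lhs_coeff_ge {cθ r X Xmax : ℝ} (hc : 0.4236636815659 ≤ cθ) (hr : r ≤ 0.20466)
    (hX0 : 0 ≤ X) (hX : X ≤ Xmax) :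
    0.4236636815659 ^ 2 - 0.20466 * Xmax ≤ cθ ^ 2 - r * X := by
  have : r * X ≤ 0.20466 * Xmax := mul_le_mul hr hX hX0 (by norm_num)
  nlinarith

end stepB

/-! ### Step C: the right-hand side of Lemma 4.7 over the normaliser `N = d²a²c`

Abstract atoms: `a = L₁^{1/3}`, `c = L₂^{1/3}`, `d = B^{1/3}` (`d³ = 4.45`), `s = √E`
(`s² = 1.8821259`); then `η = s²c²/(d²a²)`, `√η = sc/(da)`, `N = d²a²c`. -/

section stepC

variable {a c d s : ℝ} (ha : 0 < a) (hc : 0 < c) (hd : 0 < d) (hs : 0 < s)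

include ha hc hd hs in
/-- `√η = sc/(da)`. [folklore] -/
theorem sqrt_eta_eq : Real.sqrt (s ^ 2 * c ^ 2 / (d ^ 2 * a ^ 2)) = s * c / (d * a) := by
  rw [show s ^ 2 * c ^ 2 / (d ^ 2 * a ^ 2) = (s * c / (d * a)) ^ 2 by field_simp]
  exact Real.sqrt_sq (by positivity)

include ha hc hd hs in
/-- `η^{3/2} = η √η = s³c³/(d³a³)`. [folklore] -/
theorem eta_rpow_three_halves_eq :
    (s ^ 2 * c ^ 2 / (d ^ 2 * a ^ 2)) ^ (3 / 2 : ℝ) = s ^ 3 * c ^ 3 / (d ^ 3 * a ^ 3) := by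
  rw [rpow_three_halves_eq (by positivity), sqrt_eta_eq ha hc hd hs]
  field_simp

include ha hc hd hs in
/-- `log η = log s² + (2/3) log c³ − (2/3) log d³ − (2/3) log a³`. [folklore] -/
theorem log_eta_eq :
    Real.log (s ^ 2 * c ^ 2 / (d ^ 2 * a ^ 2))
      = Real.log (s ^ 2) + 2 / 3 * Real.log (c ^ 3) - 2 / 3 * Real.log (d ^ 3)
        - 2 / 3 * Real.log (a ^ 3) := by
  rw [Real.log_div (by positivity) (by positivity), Real.log_mul (by positivity) (by positivity),
    Real.log_mul (by positivity) (by positivity)]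
  simp only [Real.log_pow]
  push_cast
  ring

include ha hc hd hs in
/-- Algebra of `T_B` (`d³ = B = 4.45`): `(2η)⁻¹ (b · B · η^{3/2} · a³) = N · b s/2` and
`(2η)⁻¹ ((2/3)(b+1)c³ + w) = N ((b+1)/(3s²) + w/(2s²c³))`. [folklore] -/
theorem TB_identity (hd3 : d ^ 3 = 4.45) (b w : ℝ) :
    1 / (2 * (s ^ 2 * c ^ 2 / (d ^ 2 * a ^ 2)))
        * (b * (2 / 3 * c ^ 3 + 4.45 * (s ^ 3 * c ^ 3 / (d ^ 3 * a ^ 3)) * a ^ 3) + (2 / 3 * c ^ 3 + w))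
      = (d ^ 2 * a ^ 2 * c) * (b * s / 2 + (b + 1) / (3 * s ^ 2) + w / (2 * s ^ 2 * c ^ 3)) := by
  rw [← hd3]
  field_simp
  ring

include ha hc hd hs in
/-- Algebra of `T_C` (`d³ = B = 4.45`): `(M₁/N) · S = N · M₁ · S/N²` with the bracket `S` of
Lemma 4.7 expanded (`1/√η = da/(sc)`, `η⁻² = d⁴a⁴/(s⁴c⁴)`). [folklore] -/
theorem TC_identity (hd3 : d ^ 3 = 4.45) (M v : ℝ) :
    M / (d ^ 2 * a ^ 2 * c)
        * (a ^ 3 / 3 + (5.409 + 5.392 * 4.45 * (1 / (s * c / (d * a)) - 2)) * a ^ 3 + 209.1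
          + 1 / (s ^ 2 * c ^ 2 / (d ^ 2 * a ^ 2)) ^ 2 * v)
      = (d ^ 2 * a ^ 2 * c) * (M * ((1 / 3 + 5.409 - 10.784 * 4.45) / (d ^ 4 * a * c ^ 2)
          + 5.392 / (s * c ^ 3) + 209.1 / (d ^ 4 * a ^ 4 * c ^ 2) + v / (s ^ 4 * c ^ 6))) := by
  rw [← hd3]
  field_simp
  ring

/-- **Term `T_A`**: `0.087π²(b₁/b₀)(1−β)/η² ≤ N · 1.5·M₁·1.0000707/(s⁴ · 2.2147 · c⁵)`, using
`0.087π² b₁/b₀ ≤ 1.5`, `1 − β ≤ M₁/(d² u^{2/3} (log log t)^{1/3})`, `a² ≤ 1.0000707 u^{2/3}`,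
`(log log t)^{1/3} ≥ 2.2147` (MTY (5.11), `κ₁`). [cite: MossinghoffTrudgianYangRNT2024, (5.11)] -/
theorem TA_le (ha : 0 < a) (hc : 0 < c) (hd : 0 < d) (hs : 0 < s) {b₀ b₁ β u23 ll13 : ℝ}
    (hT1 : 0.087 * π ^ 2 * (b₁ / b₀) ≤ 1.5) (hβ0 : 0 ≤ 1 - β)
    (hβ : 1 - β ≤ 0.048976 / (d ^ 2 * u23 * ll13)) (hu23 : 0 < u23) (hll : 2.2147 ≤ ll13)
    (hau : a ^ 2 ≤ 1.0000707 * u23) :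
    0.087 * π ^ 2 * (b₁ / b₀) * (1 - β) / (s ^ 2 * c ^ 2 / (d ^ 2 * a ^ 2)) ^ 2
      ≤ (d ^ 2 * a ^ 2 * c) * (1.5 * 0.048976 * 1.0000707 / (s ^ 4 * 2.2147 * c ^ 5)) := by
  have hll0 : 0 < ll13 := lt_of_lt_of_le (by norm_num) hll
  have hη2 : (s ^ 2 * c ^ 2 / (d ^ 2 * a ^ 2)) ^ 2 = s ^ 4 * c ^ 4 / (d ^ 4 * a ^ 4) := by
    field_simp
  rw [hη2]
  have h1 : 0.087 * π ^ 2 * (b₁ / b₀) * (1 - β) ≤ 1.5 * (0.048976 / (d ^ 2 * u23 * ll13)) :=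
    mul_le_mul hT1 hβ hβ0 (by norm_num)
  have h2 : 0.087 * π ^ 2 * (b₁ / b₀) * (1 - β) / (s ^ 4 * c ^ 4 / (d ^ 4 * a ^ 4))
      ≤ 1.5 * (0.048976 / (d ^ 2 * u23 * ll13)) / (s ^ 4 * c ^ 4 / (d ^ 4 * a ^ 4)) :=
    div_le_div_of_nonneg_right h1 (by positivity)
  refine h2.trans ?_
  have key : a ^ 2 * 2.2147 ≤ 1.0000707 * u23 * ll13 := by
    calc a ^ 2 * 2.2147 ≤ (1.0000707 * u23) * ll13 := mul_le_mul hau hll (by norm_num) (by positivity)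
      _ = _ := by ring
  have e1 : 1.5 * (0.048976 / (d ^ 2 * u23 * ll13)) / (s ^ 4 * c ^ 4 / (d ^ 4 * a ^ 4))
      = (1.5 * 0.048976 * d ^ 2 * a ^ 2 / (s ^ 4 * c ^ 4)) * (a ^ 2 / (u23 * ll13)) := by
    field_simp
  have e2 : d ^ 2 * a ^ 2 * c * (1.5 * 0.048976 * 1.0000707 / (s ^ 4 * 2.2147 * c ^ 5))
      = (1.5 * 0.048976 * d ^ 2 * a ^ 2 / (s ^ 4 * c ^ 4)) * (1.0000707 / 2.2147) := by
    field_simp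
  rw [e1, e2]
  apply mul_le_mul_of_nonneg_left _ (by positivity)
  rw [div_le_div_iff₀ (by positivity) (by norm_num)]
  linarith

/-- **Terms `T_B`**: `(2η)⁻¹ { b/b₀ ((2/3)L₂ + Bη^{3/2}L₁ + log A) + log ζ(1+η) }
≤ N { b s/2 + (b+1)/(3s²) + W/(2 s² c³) }`,
`W = b log A + 0.002442 − log s² + (2/3) log 4.45 − (2/3) log c³`, using
`log ζ(1 + η) ≤ η − log η` and `η ≤ 0.002442` (MTY (5.12) and the display before it use Ramaré's
(3.2), `log ζ(1 + η) ≤ γη − log η` — printed with the slip `κ₂E/B^{2/3}` for `γη ≤ κ₂E`; the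
elementary `ζ(σ) ≤ σ/(σ − 1)` costs `(1 − γ)η ≤ 1.1·10⁻³` more in the bracket, which the final
margin absorbs). [cite: MossinghoffTrudgianYangRNT2024, (5.12)] -/
theorem TB_le (ha : 0 < a) (hc : 0 < c) (hd : 0 < d) (hs : 0 < s) {b Zl : ℝ}
    (hd3 : d ^ 3 = 4.45) (hlogL1 : Real.log (a ^ 3) = c ^ 3)
    (hZl : Zl ≤ s ^ 2 * c ^ 2 / (d ^ 2 * a ^ 2) - Real.log (s ^ 2 * c ^ 2 / (d ^ 2 * a ^ 2)))
    (hηle : s ^ 2 * c ^ 2 / (d ^ 2 * a ^ 2) ≤ 0.002442) :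
    1 / (2 * (s ^ 2 * c ^ 2 / (d ^ 2 * a ^ 2)))
        * (b / 1 * (2 / 3 * c ^ 3 + 4.45 * (s ^ 2 * c ^ 2 / (d ^ 2 * a ^ 2)) ^ (3 / 2 : ℝ) * a ^ 3
            + Real.log 76.2) + Zl)
      ≤ (d ^ 2 * a ^ 2 * c) * (b * s / 2 + (b + 1) / (3 * s ^ 2)
          + (b * Real.log 76.2 + 0.002442 - Real.log (s ^ 2) + 2 / 3 * Real.log 4.45
              - 2 / 3 * Real.log (c ^ 3)) / (2 * s ^ 2 * c ^ 3)) := by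
  rw [eta_rpow_three_halves_eq ha hc hd hs, div_one]
  have hlogη := log_eta_eq ha hc hd hs
  rw [hd3, hlogL1] at hlogη
  have hpos : 0 < 1 / (2 * (s ^ 2 * c ^ 2 / (d ^ 2 * a ^ 2))) := by positivity
  set w := b * Real.log 76.2 + 0.002442 - Real.log (s ^ 2) + 2 / 3 * Real.log 4.45
    - 2 / 3 * Real.log (c ^ 3) with hw
  clear_value w
  -- replace Zl by its bound
  have hZl2 := hZl
  rw [hlogη] at hZl2
  have hZl' : b * Real.log 76.2 + Zl ≤ 2 / 3 * c ^ 3 + w := by rw [hw]; linarith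
  have hid := TB_identity ha hc hd hs hd3 b w
  calc 1 / (2 * (s ^ 2 * c ^ 2 / (d ^ 2 * a ^ 2)))
        * (b * (2 / 3 * c ^ 3 + 4.45 * (s ^ 3 * c ^ 3 / (d ^ 3 * a ^ 3)) * a ^ 3 + Real.log 76.2) + Zl)
      ≤ 1 / (2 * (s ^ 2 * c ^ 2 / (d ^ 2 * a ^ 2)))
        * (b * (2 / 3 * c ^ 3 + 4.45 * (s ^ 3 * c ^ 3 / (d ^ 3 * a ^ 3)) * a ^ 3) + (2 / 3 * c ^ 3 + w)) := by
        apply mul_le_mul_of_nonneg_left _ hpos.le; linarith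
    _ = _ := by linear_combination hid

/-- **Terms `T_C`**: with `S` the bracket of Lemma 4.7, `S ≥ 0`, `λ ≤ M₁/N` and `C₅ ≤ 1.0241566`:
`C₅ (b/b₀) λ S ≤ N · 1.0241566 · b · M₁ · S/N²`, and `S/N²` expanded (MTY (5.13)).
[cite: MossinghoffTrudgianYangRNT2024, (5.13)] -/
theorem TC_le (ha : 0 < a) (hc : 0 < c) (hd : 0 < d) (hs : 0 < s) {b C lam : ℝ} (hb : 0 ≤ b)
    (hd3 : d ^ 3 = 4.45) (hs2 : s ^ 2 = 1.8821259) (hlogL1 : Real.log (a ^ 3) = c ^ 3)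
    (hC : C ≤ 1.0241566) (hlam0 : 0 ≤ lam) (hlam : lam ≤ 0.048976 / (d ^ 2 * a ^ 2 * c))
    (hac : 2 * c ≤ a) (hc3 : 10 ≤ c ^ 3) :
    C * (b / 1) * lam
        * (a ^ 3 / 3 + (5.409 + 5.392 * 4.45 * (1 / Real.sqrt (s ^ 2 * c ^ 2 / (d ^ 2 * a ^ 2)) - 2)) * a ^ 3
          + 209.1 + 1 / (s ^ 2 * c ^ 2 / (d ^ 2 * a ^ 2)) ^ 2
            * ((Real.log (76.2 / (s ^ 2 * c ^ 2 / (d ^ 2 * a ^ 2))) + 2 / 3 * c ^ 3) / 1.879 + 0.213))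
      ≤ (d ^ 2 * a ^ 2 * c) * (1.0241566 * b * (0.048976
          * ((1 / 3 + 5.409 - 10.784 * 4.45) / (d ^ 4 * a * c ^ 2) + 5.392 / (s * c ^ 3)
            + 209.1 / (d ^ 4 * a ^ 4 * c ^ 2)
            + ((4 / 3 * c ^ 3 + Real.log 76.2 - Real.log (s ^ 2) + 2 / 3 * Real.log 4.45
                - 2 / 3 * Real.log (c ^ 3)) / 1.879 + 0.213) / (s ^ 4 * c ^ 6)))) := by
  rw [sqrt_eta_eq ha hc hd hs, div_one]
  have hlogη := log_eta_eq ha hc hd hs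
  rw [hd3, hlogL1] at hlogη
  have hlog76 : Real.log (76.2 / (s ^ 2 * c ^ 2 / (d ^ 2 * a ^ 2)))
      = Real.log 76.2 - (Real.log (s ^ 2) + 2 / 3 * Real.log (c ^ 3) - 2 / 3 * Real.log 4.45
        - 2 / 3 * c ^ 3) := by
    rw [Real.log_div (by norm_num) (by positivity), hlogη]
  rw [hlog76]
  set v := (4 / 3 * c ^ 3 + Real.log 76.2 - Real.log (s ^ 2) + 2 / 3 * Real.log 4.45
    - 2 / 3 * Real.log (c ^ 3)) / 1.879 + 0.213 with hv
  clear_value v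
  have hv' : (Real.log 76.2 - (Real.log (s ^ 2) + 2 / 3 * Real.log (c ^ 3) - 2 / 3 * Real.log 4.45
      - 2 / 3 * c ^ 3) + 2 / 3 * c ^ 3) / 1.879 + 0.213 = v := by rw [hv]; ring
  rw [hv']
  -- the bracket S and its sign
  set S := a ^ 3 / 3 + (5.409 + 5.392 * 4.45 * (1 / (s * c / (d * a)) - 2)) * a ^ 3 + 209.1
      + 1 / (s ^ 2 * c ^ 2 / (d ^ 2 * a ^ 2)) ^ 2 * v with hS
  clear_value S
  have hd1 : 1.6448 ≤ d := by nlinarith [sq_nonneg (d - 1.6448), sq_nonneg d]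
  have hs1 : s ≤ 1.372 := by nlinarith
  have hlogA := log_A_mem.1
  have hlogB := log_B_mem.1
  have hlogs : Real.log (s ^ 2) ≤ 0.632402 := by rw [hs2]; exact log_E_mem.2
  have hlogc : Real.log (c ^ 3) ≤ c ^ 3 := by
    have := Real.log_le_sub_one_of_pos (show (0:ℝ) < c ^ 3 by positivity); linarith
  have hv0 : 0 ≤ v := by
    rw [hv]
    have : 0 ≤ 4 / 3 * c ^ 3 + Real.log 76.2 - Real.log (s ^ 2) + 2 / 3 * Real.log 4.45
        - 2 / 3 * Real.log (c ^ 3) := by linarith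
    positivity
  have hS0 : 0 ≤ S := by
    rw [hS]
    have h1 : 1 / (s * c / (d * a)) = d * a / (s * c) := by field_simp
    rw [h1]
    have h2 : 2 * 1.6448 / 1.372 ≤ d * a / (s * c) := by
      rw [div_le_div_iff₀ (by norm_num) (by positivity)]
      have : 1.6448 * (2 * c) ≤ d * a := mul_le_mul hd1 hac (by positivity) hd.le
      nlinarith
    have h2' : (0 : ℝ) ≤ d * a / (s * c) - 2 := by
      have : (2 : ℝ) ≤ 2 * 1.6448 / 1.372 := by norm_num
      linarith
    have h3 : 0 ≤ 1 / (s ^ 2 * c ^ 2 / (d ^ 2 * a ^ 2)) ^ 2 * v := mul_nonneg (by positivity) hv0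
    have h4 : 0 ≤ (5.409 + 5.392 * 4.45 * (d * a / (s * c) - 2)) * a ^ 3 :=
      mul_nonneg (by nlinarith) (by positivity)
    have h5 : 0 ≤ a ^ 3 / 3 := by positivity
    linarith
  -- C · b · lam · S ≤ 1.0241566 · b · (M1/N) · S
  have step1 : C * b * lam * S ≤ 1.0241566 * b * (0.048976 / (d ^ 2 * a ^ 2 * c)) * S := by
    have e1 : C * b * lam * S = C * (b * lam * S) := by ring
    have e2 : 1.0241566 * b * (0.048976 / (d ^ 2 * a ^ 2 * c)) * S
        = 1.0241566 * (b * (0.048976 / (d ^ 2 * a ^ 2 * c)) * S) := by ring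
    rw [e1, e2]
    apply mul_le_mul hC _ (by positivity) (by norm_num)
    exact mul_le_mul_of_nonneg_right (mul_le_mul_of_nonneg_left hlam hb) hS0
  refine step1.trans (le_of_eq ?_)
  have hid := TC_identity ha hc hd hs hd3 0.048976 v
  rw [hS]
  linear_combination (1.0241566 * b) * hid

end stepC

end Literature.NumberTheory.LFunctions.VK
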